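import Summits.Schanuel.Schanuel.Theorems.RootDecomp1KHyper10

/-!
# RootDecomp1KHyper — part 11 of the «HyperCarving» port wave (lens 6, gen 9 = ROUND 4 of route-Schanuel-RootDecomp1K; 19 parts planned)

Mechanical port (census-1 gen 7, dependency closure; tools census/tools/gen7/portkit2.py + build_l6g9.py) of §17 of HOME/decomp-schanuel-lens-6/g9/HyperCarving.lean
(sha256 aba5c91f…, 8041 l; critic CLEARED FOR TYPING 2026-08-30T13:33:07Z; writer PATH A″ rev 5–8) together with the §§0–16 declarations it depends on
(nothing of the node was in the tree before except RootDecomp1KLinLiouvilleSplit and the Literature fact NesterenkoWaldschmidt1996_thm_5_1).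
This part: node lines 5141–5480 (23 declarations: FC_cast, contDiff_FC, exists_lipschitz_FC, aeval_AC, natDegree_AC_le, coeff_AC …).
All parts share the namespace `Summit.Schanuel.Schanuel.Theorems.RootDecomp1KHyper` (node sub-namespace `HyperCell` reproduced); statements and proofs
are the node's verbatim; `--supports stmt-Schanuel-33363` (A₄ʰ HyperLiouvilleSchanuel). Sorry-free; standard axioms. Nothing here proves Schanuel; rung 0.
-/

set_option linter.dupNamespace false
set_option linter.unusedSectionVars false

noncomputable section

open Complex IntermediateField Filter Polynomial

namespace Summit.Schanuel.Schanuel.Theorems.RootDecomp1KHyper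

variable {n K : ℕ}

namespace HyperCell

variable {n K : ℕ}

/-- `x · e^{−x} ≤ 1`. -/
private theorem mul_exp_neg_le_one (x : ℝ) : x * Real.exp (-x) ≤ 1 := by
  rw [Real.exp_neg, ← div_eq_mul_inv, div_le_one (Real.exp_pos x)]
  linarith [Real.add_one_le_exp x]

/-- §16h. Every level: the moment curve (ℓ, ℓ², …, ℓⁿ) through a hyper-Liouville ℓ: auxiliary statement `FC_cast` (lens 6 gen 9 node, ported verbatim). -/
theorem FC_cast (P : MvPolynomial (Fin (n + 1)) ℤ) (x : ℝ) :
    ((FC P x : ℝ) : ℂ) = MvPolynomial.aeval (curvePt n (x : ℂ)) P := by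
  rw [MvPolynomial.aeval_def, MvPolynomial.eval₂_eq', FC]
  push_cast
  refine Finset.sum_congr rfl fun s _ => ?_
  rw [Fin.prod_univ_succ]
  simp only [algebraMap_int_eq, eq_intCast, curvePt, Fin.cons_zero, Fin.cons_succ]
  have hprod : ∏ i : Fin n, cexp ((x : ℂ) ^ ((i : ℕ) + 1)) ^ (s i.succ) =
      cexp (∑ i : Fin n, ((s i.succ : ℕ) : ℂ) * (x : ℂ) ^ ((i : ℕ) + 1)) := by
    rw [Complex.exp_sum]
    exact Finset.prod_congr rfl fun i _ => by rw [← Complex.exp_nat_mul]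
  rw [hprod]
  ring

/-- §16h. Every level: the moment curve (ℓ, ℓ², …, ℓⁿ) through a hyper-Liouville ℓ: auxiliary statement `contDiff_FC` (lens 6 gen 9 node, ported verbatim). -/
theorem contDiff_FC (P : MvPolynomial (Fin (n + 1)) ℤ) : ContDiff ℝ 1 (FC P) := by
  unfold FC
  refine ContDiff.sum fun s _ => ?_
  exact (contDiff_const.mul (contDiff_id.pow _)).mul
    (Real.contDiff_exp.comp (ContDiff.sum fun i _ => contDiff_const.mul (contDiff_id.pow _)))

/-- §16h. Every level: the moment curve (ℓ, ℓ², …, ℓⁿ) through a hyper-Liouville ℓ: auxiliary statement `exists_lipschitz_FC` (lens 6 gen 9 node, ported verbatim). -/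
theorem exists_lipschitz_FC (P : MvPolynomial (Fin (n + 1)) ℤ) (ℓ : ℝ) :
    ∃ Kl δ₁ : ℝ, 0 ≤ Kl ∧ 0 < δ₁ ∧ ∀ x : ℝ, |x - ℓ| < δ₁ → |FC P x - FC P ℓ| ≤ Kl * |x - ℓ| := by
  obtain ⟨K, t, ht, hK⟩ := ((contDiff_FC P).contDiffAt (x := ℓ)).exists_lipschitzOnWith
  obtain ⟨δ₁, hδ₁, hball⟩ := Metric.mem_nhds_iff.mp ht
  refine ⟨K, δ₁, K.2, hδ₁, fun x hx => ?_⟩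
  have hxt : x ∈ t := hball (by rw [Metric.mem_ball, Real.dist_eq]; exact hx)
  have hℓt : ℓ ∈ t := hball (Metric.mem_ball_self hδ₁)
  have := (lipschitzOnWith_iff_dist_le_mul.mp hK) x hxt ℓ hℓt
  rwa [Real.dist_eq, Real.dist_eq] at this

/-- §16h. Every level: the moment curve (ℓ, ℓ², …, ℓⁿ) through a hyper-Liouville ℓ: auxiliary statement `aeval_AC` (lens 6 gen 9 node, ported verbatim). -/
theorem aeval_AC (P : MvPolynomial (Fin (n + 1)) ℤ) {D p q : ℕ} (hD : ∀ s ∈ P.support, s 0 ≤ D)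
    (hq : q ≠ 0) (γ : ℂ) :
    aeval γ (AC P D p q) =
      (q : ℂ) ^ D * MvPolynomial.aeval (Fin.cons ((p : ℂ) / q) fun i : Fin n => γ ^ Ewt n q p i) P := by
  unfold AC
  rw [map_sum, MvPolynomial.aeval_def, MvPolynomial.eval₂_eq', Finset.mul_sum]
  refine Finset.sum_congr rfl fun s hs => ?_
  rw [map_mul, map_pow, aeval_X, aeval_C, Fin.prod_univ_succ]
  simp only [algebraMap_int_eq, eq_intCast, Fin.cons_zero, Fin.cons_succ]
  have hs0 : s 0 ≤ D := hD s hs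
  have hqC : (q : ℂ) ≠ 0 := by exact_mod_cast hq
  have hsplit : (q : ℂ) ^ D = (q : ℂ) ^ (s 0) * (q : ℂ) ^ (D - s 0) := by
    rw [← pow_add, Nat.add_sub_cancel' hs0]
  have hex : γ ^ exC n q p s = ∏ i : Fin n, (γ ^ Ewt n q p i) ^ (s i.succ) := by
    rw [exC, ← Finset.prod_pow_eq_pow_sum]
    refine Finset.prod_congr rfl fun i _ => ?_
    rw [← pow_mul, mul_comm]
  simp only [coC, Int.cast_mul, Int.cast_pow, Int.cast_natCast]
  rw [hex, hsplit, div_pow]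
  field_simp

/-- §16h. Every level: the moment curve (ℓ, ℓ², …, ℓⁿ) through a hyper-Liouville ℓ: auxiliary statement `natDegree_AC_le` (lens 6 gen 9 node, ported verbatim). -/
theorem natDegree_AC_le (P : MvPolynomial (Fin (n + 1)) ℤ) (D p q : ℕ) {N : ℕ}
    (hN : ∀ s ∈ P.support, exC n q p s ≤ N) : (AC P D p q).natDegree ≤ N := by
  unfold AC
  refine Polynomial.natDegree_sum_le_of_forall_le _ _ fun s hs => ?_
  exact (Polynomial.natDegree_C_mul_X_pow_le _ _).trans (hN s hs)

/-- §16h. Every level: the moment curve (ℓ, ℓ², …, ℓⁿ) through a hyper-Liouville ℓ: auxiliary statement `coeff_AC` (lens 6 gen 9 node, ported verbatim). -/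
theorem coeff_AC (P : MvPolynomial (Fin (n + 1)) ℤ) (D p q j : ℕ) :
    (AC P D p q).coeff j = ∑ s ∈ P.support with exC n q p s = j, coC P D p q s := by
  unfold AC
  rw [finsetSum_coeff, Finset.sum_filter]
  refine Finset.sum_congr rfl fun s _ => ?_
  rw [Polynomial.coeff_C_mul_X_pow]
  by_cases h : exC n q p s = j
  · rw [if_pos h.symm, if_pos h]
  · rw [if_neg (Ne.symm h), if_neg h]

/-- §16h. Every level: the moment curve (ℓ, ℓ², …, ℓⁿ) through a hyper-Liouville ℓ: auxiliary statement `abs_coC_le` (lens 6 gen 9 node, ported verbatim). -/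
theorem abs_coC_le (P : MvPolynomial (Fin (n + 1)) ℤ) {D p q : ℕ} {s : Fin (n + 1) →₀ ℕ}
    (hs : s 0 ≤ D) : |coC P D p q s| ≤ ((p : ℤ) + q) ^ D * |P.coeff s| := by
  unfold coC
  rw [abs_mul, abs_mul, abs_pow, abs_pow, Nat.abs_cast, Nat.abs_cast]
  have h1 : (p : ℤ) ^ (s 0) ≤ ((p : ℤ) + q) ^ (s 0) :=
    pow_le_pow_left₀ (by positivity) (by linarith [Int.natCast_nonneg q]) _
  have h2 : (q : ℤ) ^ (D - s 0) ≤ ((p : ℤ) + q) ^ (D - s 0) :=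
    pow_le_pow_left₀ (by positivity) (by linarith [Int.natCast_nonneg p]) _
  calc |P.coeff s| * (p : ℤ) ^ (s 0) * (q : ℤ) ^ (D - s 0)
      ≤ |P.coeff s| * ((p : ℤ) + q) ^ (s 0) * ((p : ℤ) + q) ^ (D - s 0) := by gcongr
    _ = ((p : ℤ) + q) ^ D * |P.coeff s| := by
        rw [mul_assoc, ← pow_add, Nat.add_sub_cancel' hs]; ring

/-- §16h. Every level: the moment curve (ℓ, ℓ², …, ℓⁿ) through a hyper-Liouville ℓ: auxiliary statement `sum_abs_coeff_AC_le` (lens 6 gen 9 node, ported verbatim). -/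
theorem sum_abs_coeff_AC_le (P : MvPolynomial (Fin (n + 1)) ℤ) {D p q : ℕ}
    (hD : ∀ s ∈ P.support, s 0 ≤ D) {N : ℕ} (hN : ∀ s ∈ P.support, exC n q p s ≤ N) :
    ∑ j ∈ Finset.range (N + 1), |(AC P D p q).coeff j| ≤ ((p : ℤ) + q) ^ D * mvlen P := by
  calc ∑ j ∈ Finset.range (N + 1), |(AC P D p q).coeff j|
      ≤ ∑ j ∈ Finset.range (N + 1), ∑ s ∈ P.support with exC n q p s = j, |coC P D p q s| :=
        Finset.sum_le_sum fun j _ => by rw [coeff_AC]; exact Finset.abs_sum_le_sum_abs _ _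
    _ = ∑ s ∈ P.support, |coC P D p q s| :=
        Finset.sum_fiberwise_of_maps_to
          (fun s hs => Finset.mem_range.mpr (Nat.lt_succ_of_le (hN s hs))) _
    _ ≤ ∑ s ∈ P.support, ((p : ℤ) + q) ^ D * |P.coeff s| :=
        Finset.sum_le_sum fun s hs => abs_coC_le P (hD s hs)
    _ = ((p : ℤ) + q) ^ D * mvlen P := by rw [mvlen, Finset.mul_sum]

/-- §16h. Every level: the moment curve (ℓ, ℓ², …, ℓⁿ) through a hyper-Liouville ℓ: auxiliary statement `apply_le_totalDegree'` (lens 6 gen 9 node, ported verbatim). -/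
private theorem apply_le_totalDegree' {P : MvPolynomial (Fin (n + 1)) ℤ} {s : Fin (n + 1) →₀ ℕ}
    (hs : s ∈ P.support) (i : Fin (n + 1)) : s i ≤ P.totalDegree := by
  refine le_trans ?_ (MvPolynomial.le_totalDegree hs)
  by_cases hi : i ∈ s.support
  · exact Finset.single_le_sum (f := fun j => s j) (fun _ _ => Nat.zero_le _) hi
  · simp [Finsupp.notMem_support_iff.mp hi]

/-- §16h. Every level: the moment curve (ℓ, ℓ², …, ℓⁿ) through a hyper-Liouville ℓ: auxiliary statement `sum_succ_le_totalDegree` (lens 6 gen 9 node, ported verbatim). -/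
private theorem sum_succ_le_totalDegree {P : MvPolynomial (Fin (n + 1)) ℤ} {s : Fin (n + 1) →₀ ℕ}
    (hs : s ∈ P.support) : ∑ i : Fin n, s i.succ ≤ P.totalDegree := by
  refine le_trans ?_ (MvPolynomial.le_totalDegree hs)
  have h : (s.sum fun _ e => e) = ∑ j : Fin (n + 1), s j := by
    rw [Finsupp.sum_fintype]; intro; rfl
  rw [h, Fin.sum_univ_succ]
  omega

/-- exponent bound `exC s ≤ deg P · (p + q)ⁿ` -/
theorem exC_le {P : MvPolynomial (Fin (n + 1)) ℤ} {s : Fin (n + 1) →₀ ℕ} (hs : s ∈ P.support)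
    (q p : ℕ) : exC n q p s ≤ P.totalDegree * (p + q) ^ n := by
  have hE : ∀ i : Fin n, Ewt n q p i ≤ (p + q) ^ n := by
    intro i
    unfold Ewt
    have hi : (i : ℕ) + 1 ≤ n := i.2
    calc p ^ ((i : ℕ) + 1) * q ^ (n - ((i : ℕ) + 1))
        ≤ (p + q) ^ ((i : ℕ) + 1) * (p + q) ^ (n - ((i : ℕ) + 1)) :=
          Nat.mul_le_mul (Nat.pow_le_pow_left (by omega) _) (Nat.pow_le_pow_left (by omega) _)
      _ = (p + q) ^ n := by rw [← pow_add, Nat.add_sub_cancel' hi]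
  calc exC n q p s = ∑ i : Fin n, s i.succ * Ewt n q p i := rfl
    _ ≤ ∑ i : Fin n, s i.succ * (p + q) ^ n :=
        Finset.sum_le_sum fun i _ => Nat.mul_le_mul_left _ (hE i)
    _ = (∑ i : Fin n, s i.succ) * (p + q) ^ n := by rw [Finset.sum_mul]
    _ ≤ P.totalDegree * (p + q) ^ n := Nat.mul_le_mul_right _ (sum_succ_le_totalDegree hs)

/-- the collision-detecting polynomial: product of all `Σ_i c_i X^{i+1}`, `0 < |c|∞ ≤ d` -/
def collPoly (n d : ℕ) : ℂ[X] :=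
  ∏ c ∈ (Fintype.piFinset fun _ : Fin n => Finset.Icc (-(d : ℤ)) d) with c ≠ 0,
    ∑ i : Fin n, C ((c i : ℤ) : ℂ) * X ^ ((i : ℕ) + 1)

/-- §16h. Every level: the moment curve (ℓ, ℓ², …, ℓⁿ) through a hyper-Liouville ℓ: auxiliary statement `linPoly_ne_zero` (lens 6 gen 9 node, ported verbatim). -/
private theorem linPoly_ne_zero {c : Fin n → ℤ} (hc : c ≠ 0) :
    (∑ i : Fin n, C ((c i : ℤ) : ℂ) * X ^ ((i : ℕ) + 1) : ℂ[X]) ≠ 0 := by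
  obtain ⟨i₀, hi₀⟩ := Function.ne_iff.mp hc
  intro h0
  have hc' : (∑ i : Fin n, C ((c i : ℤ) : ℂ) * X ^ ((i : ℕ) + 1) : ℂ[X]).coeff ((i₀ : ℕ) + 1) =
      ((c i₀ : ℤ) : ℂ) := by
    rw [finsetSum_coeff]
    simp only [Polynomial.coeff_C_mul_X_pow]
    rw [Finset.sum_eq_single i₀]
    · rw [if_pos rfl]
    · intro i _ hi
      rw [if_neg]
      intro h; apply hi; exact Fin.ext (by omega)
    · intro h; exact absurd (Finset.mem_univ _) h
  rw [h0, Polynomial.coeff_zero] at hc'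
  exact hi₀ (by exact_mod_cast hc'.symm)

/-- §16h. Every level: the moment curve (ℓ, ℓ², …, ℓⁿ) through a hyper-Liouville ℓ: auxiliary statement `collPoly_ne_zero` (lens 6 gen 9 node, ported verbatim). -/
theorem collPoly_ne_zero (n d : ℕ) : collPoly n d ≠ 0 := by
  unfold collPoly
  rw [Finset.prod_ne_zero_iff]
  intro c hc
  exact linPoly_ne_zero (Finset.mem_filter.mp hc).2

/-- §16h. Every level: the moment curve (ℓ, ℓ², …, ℓⁿ) through a hyper-Liouville ℓ: auxiliary statement `eval_linPoly` (lens 6 gen 9 node, ported verbatim). -/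
private theorem eval_linPoly (c : Fin n → ℤ) (x : ℂ) :
    (∑ i : Fin n, C ((c i : ℤ) : ℂ) * X ^ ((i : ℕ) + 1) : ℂ[X]).eval x =
      ∑ i : Fin n, ((c i : ℤ) : ℂ) * x ^ ((i : ℕ) + 1) := by
  rw [Polynomial.eval_finsetSum]
  simp only [Polynomial.eval_mul, Polynomial.eval_C, Polynomial.eval_pow, Polynomial.eval_X]

/-- if `collPoly n d` does not vanish at `x`, no `0 < |c|∞ ≤ d` has `Σ c_i x^{i+1} = 0` -/
theorem no_relation_of_collPoly_ne {d : ℕ} {x : ℂ} (hx : (collPoly n d).eval x ≠ 0)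
    {c : Fin n → ℤ} (hcd : ∀ i, |c i| ≤ d) (hc : c ≠ 0) :
    ∑ i : Fin n, ((c i : ℤ) : ℂ) * x ^ ((i : ℕ) + 1) ≠ 0 := by
  unfold collPoly at hx
  rw [Polynomial.eval_prod, Finset.prod_ne_zero_iff] at hx
  have hmem : c ∈ (Fintype.piFinset fun _ : Fin n => Finset.Icc (-(d : ℤ)) d).filter
      (fun c => c ≠ 0) := by
    refine Finset.mem_filter.mpr ⟨Fintype.mem_piFinset.mpr fun i => ?_, hc⟩
    exact Finset.mem_Icc.mpr (abs_le.mp (hcd i))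
  have := hx c hmem
  rwa [eval_linPoly] at this

/-- no collisions: if `p/q` is not a root of `collPoly n d`, then `exC s = exC s'` with all
`s_i, s'_i ≤ d` forces `s ∘ succ = s' ∘ succ`. -/
theorem exC_inj {d q p : ℕ} (hq : q ≠ 0)
    (hx : (collPoly n d).eval ((p : ℂ) / q) ≠ 0) {s s' : Fin (n + 1) →₀ ℕ}
    (hs : ∀ i : Fin n, s i.succ ≤ d) (hs' : ∀ i : Fin n, s' i.succ ≤ d)
    (h : exC n q p s = exC n q p s') : ∀ i : Fin n, s i.succ = s' i.succ := by
  by_contra hne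
  push Not at hne
  set c : Fin n → ℤ := fun i => (s i.succ : ℤ) - s' i.succ with hcdef
  have hc0 : c ≠ 0 := by
    obtain ⟨i, hi⟩ := hne
    intro h0
    have := congrFun h0 i
    simp only [hcdef, Pi.zero_apply] at this
    omega
  have hcd : ∀ i, |c i| ≤ d := by
    intro i
    simp only [hcdef]
    have := hs i; have := hs' i
    rw [abs_le]; constructor <;> omega
  apply no_relation_of_collPoly_ne hx hcd hc0
  -- `Σ c_i (p/q)^{i+1} = (exC s − exC s') / q^n = 0`
  have hqC : (q : ℂ) ≠ 0 := by exact_mod_cast hq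
  have hE : ∀ i : Fin n, (Ewt n q p i : ℂ) = ((p : ℂ) / q) ^ ((i : ℕ) + 1) * (q : ℂ) ^ n := by
    intro i
    have hi : (i : ℕ) + 1 ≤ n := i.2
    unfold Ewt
    push_cast
    rw [show (q : ℂ) ^ n = (q : ℂ) ^ ((i : ℕ) + 1) * (q : ℂ) ^ (n - ((i : ℕ) + 1)) by
      rw [← pow_add, Nat.add_sub_cancel' hi], div_pow]
    field_simp
  have key : (q : ℂ) ^ n * ∑ i : Fin n, ((c i : ℤ) : ℂ) * ((p : ℂ) / q) ^ ((i : ℕ) + 1) =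
      ((exC n q p s : ℕ) : ℂ) - ((exC n q p s' : ℕ) : ℂ) := by
    simp only [hcdef, exC]
    push_cast
    rw [Finset.mul_sum, ← Finset.sum_sub_distrib]
    refine Finset.sum_congr rfl fun i _ => ?_
    rw [hE i]; ring
  rw [h, sub_self] at key
  exact (mul_eq_zero.mp key).resolve_left (pow_ne_zero _ hqC)

/-- the fibre polynomial `g_t(X₀) = Σ_{s : s∘succ = t∘succ} coeff(s) X₀^{s 0}` -/
def fibC (P : MvPolynomial (Fin (n + 1)) ℤ) (t : Fin (n + 1) →₀ ℕ) : ℤ[X] :=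
  ∑ s ∈ P.support with (∀ i : Fin n, s i.succ = t i.succ), C (P.coeff s) * X ^ (s 0)

/-- §16h. Every level: the moment curve (ℓ, ℓ², …, ℓⁿ) through a hyper-Liouville ℓ: auxiliary statement `fibC_ne_zero` (lens 6 gen 9 node, ported verbatim). -/
theorem fibC_ne_zero (P : MvPolynomial (Fin (n + 1)) ℤ) {t : Fin (n + 1) →₀ ℕ}
    (ht : t ∈ P.support) : fibC P t ≠ 0 := by
  intro h0
  have hc : (fibC P t).coeff (t 0) = P.coeff t := by
    unfold fibC
    rw [finsetSum_coeff]
    simp only [Polynomial.coeff_C_mul_X_pow]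
    rw [Finset.sum_eq_single t]
    · rw [if_pos rfl]
    · intro s hs hst
      rw [if_neg]
      intro h
      apply hst
      rw [Finset.mem_filter] at hs
      ext j
      refine Fin.cases ?_ (fun i => ?_) j
      · exact h.symm
      · exact hs.2 i
    · intro h
      exact absurd (Finset.mem_filter.mpr ⟨ht, fun _ => rfl⟩) h
  rw [h0, Polynomial.coeff_zero] at hc
  exact (MvPolynomial.mem_support_iff.mp ht) hc.symm

/-- §16h. Every level: the moment curve (ℓ, ℓ², …, ℓⁿ) through a hyper-Liouville ℓ: auxiliary statement `aeval_fibC` (lens 6 gen 9 node, ported verbatim). -/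
theorem aeval_fibC (P : MvPolynomial (Fin (n + 1)) ℤ) (t : Fin (n + 1) →₀ ℕ) (x : ℂ) :
    aeval x (fibC P t) =
      ∑ s ∈ P.support with (∀ i : Fin n, s i.succ = t i.succ),
        ((P.coeff s : ℤ) : ℂ) * x ^ (s 0) := by
  unfold fibC
  rw [map_sum]
  refine Finset.sum_congr rfl fun s _ => ?_
  rw [map_mul, map_pow, aeval_X, aeval_C, algebraMap_int_eq, eq_intCast]

/-- §16h. Every level: the moment curve (ℓ, ℓ², …, ℓⁿ) through a hyper-Liouville ℓ: auxiliary statement `coeff_AC_exC_cast` (lens 6 gen 9 node, ported verbatim). -/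
theorem coeff_AC_exC_cast (P : MvPolynomial (Fin (n + 1)) ℤ) {D p q : ℕ}
    (hD : ∀ s ∈ P.support, s 0 ≤ D) (hq : q ≠ 0) {t : Fin (n + 1) →₀ ℕ}
    (hinj : ∀ s ∈ P.support, exC n q p s = exC n q p t → ∀ i : Fin n, s i.succ = t i.succ) :
    (((AC P D p q).coeff (exC n q p t) : ℤ) : ℂ) = (q : ℂ) ^ D * aeval ((p : ℂ) / q) (fibC P t) := by
  rw [coeff_AC, aeval_fibC, Finset.mul_sum]
  have hfilter : (P.support.filter fun s => exC n q p s = exC n q p t) =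
      P.support.filter fun s => ∀ i : Fin n, s i.succ = t i.succ := by
    refine Finset.filter_congr fun s hs => ⟨hinj s hs, fun h => ?_⟩
    simp only [exC, h]
  rw [hfilter]
  push_cast
  refine Finset.sum_congr rfl fun s hs => ?_
  have hs0 : s 0 ≤ D := hD s (Finset.mem_filter.mp hs).1
  have hqC : (q : ℂ) ≠ 0 := by exact_mod_cast hq
  have hsplit : (q : ℂ) ^ D = (q : ℂ) ^ (s 0) * (q : ℂ) ^ (D - s 0) := by
    rw [← pow_add, Nat.add_sub_cancel' hs0]
  simp only [coC, Int.cast_mul, Int.cast_pow, Int.cast_natCast]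
  rw [hsplit, div_pow]
  field_simp

/-- **Endgame, general exponents.** -/
theorem endgame_gen {N D q m a b : ℕ} {cN c M η δ Φ C : ℝ} (hq : 1 ≤ q) (hc : 0 ≤ c)
    (hM : 0 < M) (hN : (N : ℝ) ≤ cN * (q : ℝ) ^ b) (hlow : Real.exp (-Φ) ≤ δ)
    (hΦ : Φ ≤ c * (q : ℝ) ^ a) (hδ : δ ^ N ≤ (q : ℝ) ^ D * M * η)
    (hη : η < Real.exp (-((q : ℝ) ^ m))) (hC : cN * c + D + M + 1 ≤ C)
    (hqm : C * (q : ℝ) ^ (a + b + 1) ≤ (q : ℝ) ^ m) : False := by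
  have hq1 : (1 : ℝ) ≤ q := by exact_mod_cast hq
  have hE0 : 0 < Real.exp (-Φ) := Real.exp_pos _
  have hqab : (q : ℝ) ^ (a + b) ≤ (q : ℝ) ^ (a + b + 1) := pow_le_pow_right₀ hq1 (by omega)
  have h1 : Real.exp (-(cN * c * (q : ℝ) ^ (a + b))) ≤ δ ^ N := by
    have hNΦ : (N : ℝ) * Φ ≤ cN * c * (q : ℝ) ^ (a + b) := by
      calc (N : ℝ) * Φ ≤ N * (c * (q : ℝ) ^ a) := mul_le_mul_of_nonneg_left hΦ (Nat.cast_nonneg _)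
        _ ≤ (cN * (q : ℝ) ^ b) * (c * (q : ℝ) ^ a) := mul_le_mul_of_nonneg_right hN (by positivity)
        _ = cN * c * (q : ℝ) ^ (a + b) := by rw [pow_add]; ring
    have hpow : Real.exp (-Φ) ^ N = Real.exp (-((N : ℝ) * Φ)) := by
      rw [← Real.exp_nat_mul]; congr 1; ring
    calc Real.exp (-(cN * c * (q : ℝ) ^ (a + b))) ≤ Real.exp (-((N : ℝ) * Φ)) :=
          Real.exp_le_exp.mpr (by linarith)
      _ = Real.exp (-Φ) ^ N := hpow.symm
      _ ≤ δ ^ N := pow_le_pow_left₀ hE0.le hlow N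
  have h2 : (q : ℝ) ^ D * M * η < Real.exp (-(cN * c * (q : ℝ) ^ (a + b))) := by
    have hqq : (q : ℝ) ≤ (q : ℝ) ^ (a + b + 1) := le_self_pow₀ hq1 (by omega)
    have hq1' : (1 : ℝ) ≤ (q : ℝ) ^ (a + b + 1) := one_le_pow₀ hq1
    have hD0 : (0 : ℝ) ≤ D := Nat.cast_nonneg _
    have hcNc : cN * c * (q : ℝ) ^ (a + b) ≤ cN * c * (q : ℝ) ^ (a + b + 1) := by
      rcases le_or_gt 0 (cN * c) with h | h
      · exact mul_le_mul_of_nonneg_left hqab h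
      · -- `cN * c < 0` contradicts `N ≥ 0`-free facts only if needed; but then use `c ≥ 0`
        have hcN : cN < 0 := by
          by_contra h'; push Not at h'; exact absurd (mul_nonneg h' hc) (not_le.mpr h)
        have : (N : ℝ) ≤ cN * (q : ℝ) ^ b := hN
        have hneg : cN * (q : ℝ) ^ b < 0 := mul_neg_of_neg_of_pos hcN (by positivity)
        linarith [(Nat.cast_nonneg N : (0 : ℝ) ≤ N)]
    have step1 : (q : ℝ) ^ D * M * η < (q : ℝ) ^ D * M * Real.exp (-((q : ℝ) ^ m)) :=
      mul_lt_mul_of_pos_left hη (by positivity)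
    have step2 : Real.exp (-((q : ℝ) ^ m)) ≤
        Real.exp (-(cN * c * (q : ℝ) ^ (a + b))) * (Real.exp (-((D : ℝ) * q)) * Real.exp (-M)) := by
      rw [← Real.exp_add, ← Real.exp_add]
      refine Real.exp_le_exp.mpr ?_
      have hCq : (cN * c + D + M + 1) * (q : ℝ) ^ (a + b + 1) ≤ C * (q : ℝ) ^ (a + b + 1) :=
        mul_le_mul_of_nonneg_right hC (by positivity)
      have hexp : (cN * c + D + M + 1) * (q : ℝ) ^ (a + b + 1) =
          cN * c * (q : ℝ) ^ (a + b + 1) + D * (q : ℝ) ^ (a + b + 1) + M * (q : ℝ) ^ (a + b + 1) +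
            (q : ℝ) ^ (a + b + 1) := by ring
      have hDq : (D : ℝ) * q ≤ D * (q : ℝ) ^ (a + b + 1) := mul_le_mul_of_nonneg_left hqq hD0
      have hMq : M ≤ M * (q : ℝ) ^ (a + b + 1) := le_mul_of_one_le_right hM.le hq1'
      linarith
    have hb1 : (q : ℝ) ^ D * Real.exp (-((D : ℝ) * q)) ≤ 1 := by
      have : Real.exp (-((D : ℝ) * q)) = Real.exp (-(q : ℝ)) ^ D := by
        rw [← Real.exp_nat_mul]; congr 1; ring
      rw [this, ← mul_pow]
      exact pow_le_one₀ (by positivity) (mul_exp_neg_le_one _)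
    have hb2 : M * Real.exp (-M) ≤ 1 := mul_exp_neg_le_one M
    calc (q : ℝ) ^ D * M * η < (q : ℝ) ^ D * M * Real.exp (-((q : ℝ) ^ m)) := step1
      _ ≤ (q : ℝ) ^ D * M * (Real.exp (-(cN * c * (q : ℝ) ^ (a + b))) *
          (Real.exp (-((D : ℝ) * q)) * Real.exp (-M))) := by gcongr
      _ = Real.exp (-(cN * c * (q : ℝ) ^ (a + b))) *
          (((q : ℝ) ^ D * Real.exp (-((D : ℝ) * q))) * (M * Real.exp (-M))) := by ring
      _ ≤ Real.exp (-(cN * c * (q : ℝ) ^ (a + b))) * (1 * 1) := by gcongr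
      _ = Real.exp (-(cN * c * (q : ℝ) ^ (a + b))) := by ring
  linarith [h1, h2, hδ]

/-- §16h. Every level: the moment curve (ℓ, ℓ², …, ℓⁿ) through a hyper-Liouville ℓ: auxiliary statement `Ewt_cast` (lens 6 gen 9 node, ported verbatim). -/
theorem Ewt_cast {q : ℕ} (hq : q ≠ 0) (p : ℕ) (i : Fin n) :
    (Ewt n q p i : ℂ) = ((p : ℂ) / q) ^ ((i : ℕ) + 1) * (q : ℂ) ^ n := by
  have hqC : (q : ℂ) ≠ 0 := by exact_mod_cast hq
  have hi : (i : ℕ) + 1 ≤ n := i.2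
  unfold Ewt
  push_cast
  rw [show (q : ℂ) ^ n = (q : ℂ) ^ ((i : ℕ) + 1) * (q : ℂ) ^ (n - ((i : ℕ) + 1)) by
    rw [← pow_add, Nat.add_sub_cancel' hi], div_pow]
  field_simp

end HyperCell

end Summit.Schanuel.Schanuel.Theorems.RootDecomp1KHyper
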